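import Summits.QuantumFields.YangMills.Theorems.UnitScaleTiltHalvingBalLevelRecursion
import HarnessLib

/-!
# Line H (`BirthV10.stub_halvingStep`, stmt-QuantumFields-19200) — (M2′) (b)-row: (B-al-4)₄ — THE LEVEL SEQUENCE `E` OF THE EFFECTIVE-GAUGE TOWER
# (discharge of the four numeric rows `hE0 hE1 hE hθG` of ★★★`HalvingEffGaugeRowG.hG_of_rows` from geometric per-level majorants of the stair sizes `hh` and
# the oscillations `ω`, with a k-UNIFORM top value `θG := 3·(23040·h⋆·w⋆ + 4800·w⋆²)`)

Cell `ym3-torus` (HUMAN RULING D-0037: YM₃ on T³ is ladder rung R3 — NOT d = 4, NOT infinite volume, NOT a mass gap, NOT the Clay problem), width seat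
`ym-ust-20520-w3` gen 10 (lineage of the B-al-3 door ✓p696030 and the (B-al-4)₁∕₂ bricks ✓p692310∕✓p694594∕✓p696898; the (B-al-4)₃ core `hG_of_rows` is
ym-ust-20520-w4 g11's).  `--supports stmt-QuantumFields-19200 --as helper`; THEOREMS ONLY (0 `def`, 0 `sorry`); count-neutral; nothing here claims B-al, (F-h), (F-ω),
(M2′), the stub, the crux or the gap.

WHY.  `hG_of_rows` (the row `hG` of the B-al-3 door from the stair rows and the ω-row) asks its caller for a level sequence `E : ℕ → ℝ` with
`0 ≤ E 0`, `E j ≤ 1∕200` (`j ≤ k`), the NONLINEAR level recursion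
`E j + 160·E j² + 3300·E j·(3ω j) + 5·(1536·hh j·(3ω j + (21∕10)·E j)) + 4·(1200·ω j²) ≤ E (j+1)` (`j < k`), and `E k ≤ θG`.  At the member the stair sizes
`hh j` (ROW (F-h), ✓`HalvingDbarStairSizes`) and the oscillations `ω j` (ROW (F-ω), `HalvingOmegaRow*`) are sums of monomials in the level ratio `Lʲ∕Lᵏ` — geometrically small
towards the fine levels — so the recursion is dominated by the LINEAR one `E (j+1) = 2·E j + b·t^{k−1−j}` (`t = L⁻¹ ≤ 1∕3`, `b = 23040·h⋆·w⋆ + 4800·w⋆²`) once the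
amplification `160·E j + 9900·ω j + 16128·hh j ≤ 1` is inside a window; ✓`HalvingBalLevelRecursion.recursion_geometric_source_invariant` (px10 g4) then gives
`E i ≤ 3b·t^{k−i}`, so `θG := 3b` is independent of the number of levels `k = K − n` — the k-uniformity the (M2′) assembly's θ-row needs.
* §1 `levelSeq_*` — the explicit majorant sequence (a `Nat.rec`, no `def`) and its sizes;
* §2 ★★★ `exists_levelSeq` ∕ ★★★ `exists_levelSeq_rows` — the four rows of `hG_of_rows` VERBATIM, `θG := 3·(23040·h⋆·w⋆ + 4800·w⋆²)`;
* §3 `levelRatio_*` ∕ ★ `exists_levelSeq_rows_L` — the same in the suppliers' letter `hh j ≤ h⋆·(Lʲ·(Lᵏ)⁻¹)`, `ω j ≤ w⋆·(Lʲ·(Lᵏ)⁻¹)` (`3 ≤ L`), with the monomial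
  majorants `(Lʲ·(Lᵏ)⁻¹)^m ≤ Lʲ·(Lᵏ)⁻¹` a knit uses to bring (F-h)'s and (F-ω)'s closed forms to that shape, the uniform-window reader `le_of_le_mul_levelRatio`, and the
  ADAPTER ★ `stairSize_closedForm_le_mul_levelRatio` for ROW (F-h)'s closed form `4ℓ·(dd·(4ε₀(Lʲ)²((Lᵏ)⁻¹)²) + (102∕100)·(R·((Lʲ)⁴((Lᵏ)⁻¹)⁴)))` token for token;
* §4 (v1.1) `omegaForm_le_mul_of_le_mul` ∕ `pow_mul_inv_pow_mul_eq` ∕ ★ `omega_closedForm_le_mul_levelRatio` — the ADAPTER for ROW (F-ω)'s `c′`-free closed form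
  `X + 2A + A² + (2A + A²)·X` (`HalvingOmegaRowMember.omegaRow_of_guards` v3) ↦ `w⋆·(Lʲ(Lᵏ)⁻¹)`.
HONEST SCOPE.  Pure real arithmetic (an explicit linear majorant and one induction); no lattice object appears; the windows `160·(3b) + 9900·w⋆ + 16128·h⋆ ≤ 1`,
`3b ≤ 1∕200` are ε₀∕c′-windows owned by the assembly.

References: T. Bałaban, CMP **98** (1985) 17–51 [Balaban1985Averaging] (Prop. 4, (134)–(144) pp.38–40: the iterated one-step bounds and their level sums);
CMP **99** (1985) 75–102 [Balaban1985RegularSpaces] ((1.29) p.81).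
-/

set_option autoImplicit false

namespace Summit.QuantumFields.YangMills.Theorems.HalvingEffGaugeLevelSeq

open Summit.QuantumFields.YangMills.Theorems.HalvingBalLevelRecursion (recursion_geometric_source_invariant)

/-! ## §1 The explicit linear majorant `E (j+1) = 2·E j + b·t^{k−1−j}`, `E 0 = 0` -/

/-- §1 The majorant sequence is nonnegative at every level (`0 ≤ b`, `0 ≤ t`). [cite: Balaban1985Averaging, Prop. 4 (139)-(144) pp.39-40] -/
theorem levelSeq_nonneg {b t : ℝ} (hb : 0 ≤ b) (ht : 0 ≤ t) (k : ℕ) :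
    ∀ i, 0 ≤ (fun i => Nat.rec (motive := fun _ => ℝ) 0 (fun j r => 2 * r + b * t ^ (k - (j + 1))) i) i := by
  intro i
  induction i with
  | zero => exact le_rfl
  | succ j ih =>
      show 0 ≤ 2 * Nat.rec (motive := fun _ => ℝ) 0 (fun j r => 2 * r + b * t ^ (k - (j + 1))) j + b * t ^ (k - (j + 1))
      positivity

/-- §1 The majorant sequence is geometrically small towards the fine levels: `E i ≤ 3·b·t^{k−i}` for `i ≤ k` when `0 ≤ t ≤ 1∕3`
(✓`recursion_geometric_source_invariant` with `a = 2`, `(1 − 2t)⁻¹ ≤ 3`). [cite: Balaban1985Averaging, Prop. 4 (51) p.27, (139)-(144) pp.39-40] -/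
theorem levelSeq_le_geometric {b t : ℝ} (hb : 0 ≤ b) (ht0 : 0 ≤ t) (ht1 : t ≤ 1 / 3) (k : ℕ) :
    ∀ i, i ≤ k → (fun i => Nat.rec (motive := fun _ => ℝ) 0 (fun j r => 2 * r + b * t ^ (k - (j + 1))) i) i ≤ 3 * b * t ^ (k - i) := by
  intro i hi
  have hat : (2 : ℝ) * t < 1 := by linarith
  have h := recursion_geometric_source_invariant (a := 2) (by norm_num) hb ht0 hat k
    (fun i => Nat.rec (motive := fun _ => ℝ) 0 (fun j r => 2 * r + b * t ^ (k - (j + 1))) i) rfl (fun j _ => le_rfl) i hi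
  have hB : (1 - 2 * t)⁻¹ ≤ (3 : ℝ) := by
    rw [inv_le_comm₀ (by linarith) (by norm_num)]
    linarith
  have htki : 0 ≤ t ^ (k - i) := pow_nonneg ht0 _
  calc _ ≤ b * (1 - 2 * t)⁻¹ * t ^ (k - i) := h
    _ ≤ b * 3 * t ^ (k - i) := mul_le_mul_of_nonneg_right (mul_le_mul_of_nonneg_left hB hb) htki
    _ = 3 * b * t ^ (k - i) := by ring

/-! ## §2 The four numeric rows of `hG_of_rows` -/

/-- ★★★ **THE LEVEL SEQUENCE OF THE EFFECTIVE-GAUGE TOWER.**  For `0 ≤ t ≤ 1∕3`, nonnegative per-level sizes `hh j ≤ h⋆·t^{k−1−j}`, `ω j ≤ w⋆·t^{k−1−j}` (`j < k`)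
and the windows `160·(3b) + 9900·w⋆ + 16128·h⋆ ≤ 1`, `3b ≤ 1∕200` with `b := 23040·h⋆·w⋆ + 4800·w⋆²`, there is `E : ℕ → ℝ` with `E 0 = 0`, `0 ≤ E i ≤ 3b·t^{k−i}`
(`i ≤ k`), `E j ≤ 1∕200` (`j ≤ k`), the level recursion of ★★★`HalvingEffGaugeRowG.hG_of_rows` (row `hE`, VERBATIM) and `E k ≤ 3b` — k-UNIFORM.
Proof: the linear majorant of §1; the amplification `(160·E j + 9900·ω j + 16128·hh j)·E j ≤ E j` by the first window and the source
`23040·hh j·ω j + 4800·ω j² ≤ b·t^{2(k−1−j)} ≤ b·t^{k−1−j}`. [cite: Balaban1985Averaging, Prop. 4 (134)-(135) pp.38-39, (139)-(144) pp.39-40; Balaban1985RegularSpaces, (1.29) p.81] -/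
theorem exists_levelSeq (k : ℕ) {t hs ws : ℝ} (ht0 : 0 ≤ t) (ht1 : t ≤ 1 / 3) (hhs : 0 ≤ hs) (hws : 0 ≤ ws)
    (hh ω : ℕ → ℝ) (hh0 : ∀ j, j < k → 0 ≤ hh j) (hω0 : ∀ j, j < k → 0 ≤ ω j)
    (hhh : ∀ j, j < k → hh j ≤ hs * t ^ (k - (j + 1))) (hωω : ∀ j, j < k → ω j ≤ ws * t ^ (k - (j + 1)))
    (hwin : 160 * (3 * (23040 * hs * ws + 4800 * ws ^ 2)) + 9900 * ws + 16128 * hs ≤ 1)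
    (hsmall : 3 * (23040 * hs * ws + 4800 * ws ^ 2) ≤ 1 / 200) :
    ∃ E : ℕ → ℝ, E 0 = 0 ∧ (∀ i, i ≤ k → 0 ≤ E i ∧ E i ≤ 3 * (23040 * hs * ws + 4800 * ws ^ 2) * t ^ (k - i)) ∧
      (∀ j, j ≤ k → E j ≤ 1 / 200) ∧
      (∀ j, j < k →
        E j + 160 * E j ^ 2 + 3300 * E j * (3 * ω j) + 5 * (1536 * hh j * (3 * ω j + 21 / 10 * E j)) + 4 * (1200 * ω j ^ 2) ≤ E (j + 1)) ∧
      E k ≤ 3 * (23040 * hs * ws + 4800 * ws ^ 2) := by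
  set b : ℝ := 23040 * hs * ws + 4800 * ws ^ 2 with hb_def
  have hb : 0 ≤ b := by rw [hb_def]; positivity
  -- the majorant
  let E : ℕ → ℝ := fun i => Nat.rec (motive := fun _ => ℝ) 0 (fun j r => 2 * r + b * t ^ (k - (j + 1))) i
  have hE0 : E 0 = 0 := rfl
  have hEs : ∀ j, E (j + 1) = 2 * E j + b * t ^ (k - (j + 1)) := fun j => rfl
  have hEnn : ∀ i, 0 ≤ E i := levelSeq_nonneg hb ht0 k
  have hEgeo : ∀ i, i ≤ k → E i ≤ 3 * b * t ^ (k - i) := levelSeq_le_geometric hb ht0 ht1 k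
  have ht1' : t ≤ 1 := ht1.trans (by norm_num)
  have htpow1 : ∀ m : ℕ, t ^ m ≤ 1 := fun m => pow_le_one₀ ht0 ht1'
  have h3b : 0 ≤ 3 * b := by positivity
  have hE3b : ∀ i, i ≤ k → E i ≤ 3 * b := fun i hi => (hEgeo i hi).trans (mul_le_of_le_one_right h3b (htpow1 (k - i)))
  refine ⟨E, hE0, fun i hi => ⟨hEnn i, hEgeo i hi⟩, fun j hj => (hE3b j hj).trans hsmall, ?_, hE3b k le_rfl⟩
  -- the level recursion
  intro j hj
  set m : ℕ := k - (j + 1) with hm_def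
  have htm0 : 0 ≤ t ^ m := pow_nonneg ht0 _
  have htm1 : t ^ m ≤ 1 := htpow1 m
  have hEj0 : 0 ≤ E j := hEnn j
  have hEj : E j ≤ 3 * b := hE3b j hj.le
  have hhj0 : 0 ≤ hh j := hh0 j hj
  have hωj0 : 0 ≤ ω j := hω0 j hj
  have hhj : hh j ≤ hs * t ^ m := hhh j hj
  have hωj : ω j ≤ ws * t ^ m := hωω j hj
  have hhj' : hh j ≤ hs := hhj.trans (by nlinarith)
  have hωj' : ω j ≤ ws := hωj.trans (by nlinarith)
  -- amplification inside the window
  have hamp : 160 * E j + 9900 * ω j + 16128 * hh j ≤ 1 := by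
    have h1 : 160 * E j ≤ 160 * (3 * b) := by linarith
    have h2 : 9900 * ω j ≤ 9900 * ws := by linarith
    have h3 : 16128 * hh j ≤ 16128 * hs := by linarith
    linarith
  have hampE : (160 * E j + 9900 * ω j + 16128 * hh j) * E j ≤ E j := by
    have := mul_le_mul_of_nonneg_right hamp hEj0
    linarith
  -- the source is geometric of ratio `t²`, a fortiori `t`
  have hsrc : 23040 * hh j * ω j + 4800 * ω j ^ 2 ≤ b * t ^ m := by
    have h1 : hh j * ω j ≤ (hs * t ^ m) * (ws * t ^ m) := mul_le_mul hhj hωj hωj0 (by positivity)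
    have h2 : ω j ^ 2 ≤ (ws * t ^ m) ^ 2 := pow_le_pow_left₀ hωj0 hωj 2
    have h3 : t ^ m * t ^ m ≤ t ^ m := by nlinarith
    have h4 : (hs * t ^ m) * (ws * t ^ m) ≤ hs * ws * t ^ m := by
      have := mul_le_mul_of_nonneg_left h3 (mul_nonneg hhs hws)
      nlinarith
    have h5 : (ws * t ^ m) ^ 2 ≤ ws ^ 2 * t ^ m := by
      have := mul_le_mul_of_nonneg_left h3 (sq_nonneg ws)
      nlinarith
    rw [hb_def]
    nlinarith
  -- assemble
  have hlhs : E j + 160 * E j ^ 2 + 3300 * E j * (3 * ω j) + 5 * (1536 * hh j * (3 * ω j + 21 / 10 * E j)) + 4 * (1200 * ω j ^ 2) =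
      E j + (160 * E j + 9900 * ω j + 16128 * hh j) * E j + (23040 * hh j * ω j + 4800 * ω j ^ 2) := by ring
  rw [hlhs, hEs j]
  linarith

/-- ★★★ **THE FOUR NUMERIC ROWS OF `hG_of_rows`, AS ITS CALLER READS THEM**: under the hypotheses of `exists_levelSeq` there is `E : ℕ → ℝ` with
`hE0 : 0 ≤ E 0`, `hE1 : ∀ j ≤ k, E j ≤ 1∕200`, `hE : ∀ j < k, E j + 160·E j² + 3300·E j·(3·ω j) + 5·(1536·hh j·(3·ω j + 21∕10·E j)) + 4·(1200·ω j²) ≤ E (j+1)` and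
`hθG : E k ≤ θG` for every `θG ≥ 3·(23040·h⋆·w⋆ + 4800·w⋆²)` — k-UNIFORM. [cite: Balaban1985Averaging, Prop. 4 (134)-(135) pp.38-39, (139)-(144) pp.39-40] -/
theorem exists_levelSeq_rows (k : ℕ) {t hs ws θG : ℝ} (ht0 : 0 ≤ t) (ht1 : t ≤ 1 / 3) (hhs : 0 ≤ hs) (hws : 0 ≤ ws)
    (hh ω : ℕ → ℝ) (hh0 : ∀ j, j < k → 0 ≤ hh j) (hω0 : ∀ j, j < k → 0 ≤ ω j)
    (hhh : ∀ j, j < k → hh j ≤ hs * t ^ (k - (j + 1))) (hωω : ∀ j, j < k → ω j ≤ ws * t ^ (k - (j + 1)))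
    (hwin : 160 * (3 * (23040 * hs * ws + 4800 * ws ^ 2)) + 9900 * ws + 16128 * hs ≤ 1)
    (hsmall : 3 * (23040 * hs * ws + 4800 * ws ^ 2) ≤ 1 / 200) (hθG : 3 * (23040 * hs * ws + 4800 * ws ^ 2) ≤ θG) :
    ∃ E : ℕ → ℝ, 0 ≤ E 0 ∧ (∀ j, j ≤ k → E j ≤ 1 / 200) ∧
      (∀ j, j < k →
        E j + 160 * E j ^ 2 + 3300 * E j * (3 * ω j) + 5 * (1536 * hh j * (3 * ω j + 21 / 10 * E j)) + 4 * (1200 * ω j ^ 2) ≤ E (j + 1)) ∧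
      E k ≤ θG := by
  obtain ⟨E, hE0, -, hE1, hE, hEk⟩ := exists_levelSeq k ht0 ht1 hhs hws hh ω hh0 hω0 hhh hωω hwin hsmall
  exact ⟨E, hE0.ge, hE1, hE, hEk.trans hθG⟩

/-! ## §3 The suppliers' letter: the level ratio `Lʲ·(Lᵏ)⁻¹` -/

/-- §3 The level ratio is nonnegative. [cite: Balaban1985Averaging, (47) p.25] -/
theorem levelRatio_nonneg {L : ℝ} (hL : 0 ≤ L) (j k : ℕ) : 0 ≤ L ^ j * (L ^ k)⁻¹ := by positivity

/-- §3 For `j ≤ k` and `0 < L` the level ratio is a power of `L⁻¹` counted from the top: `Lʲ·(Lᵏ)⁻¹ = (L⁻¹)^{k−j}`. [cite: Balaban1985Averaging, (47) p.25] -/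
theorem levelRatio_eq_inv_pow {L : ℝ} (hL : 0 < L) {j k : ℕ} (hjk : j ≤ k) : L ^ j * (L ^ k)⁻¹ = (L⁻¹) ^ (k - j) := by
  have hLk : L ^ k = L ^ j * L ^ (k - j) := by rw [← pow_add, Nat.add_sub_cancel' hjk]
  rw [hLk, mul_inv, ← mul_assoc, mul_inv_cancel₀ (pow_ne_zero _ hL.ne'), one_mul, inv_pow]

/-- §3 For `j ≤ k` and `1 ≤ L` the level ratio is at most one. [cite: Balaban1985Averaging, (47) p.25] -/
theorem levelRatio_le_one {L : ℝ} (hL : 1 ≤ L) {j k : ℕ} (hjk : j ≤ k) : L ^ j * (L ^ k)⁻¹ ≤ 1 := by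
  have hL0 : 0 < L := by linarith
  rw [levelRatio_eq_inv_pow hL0 hjk]
  exact pow_le_one₀ (by positivity) (inv_le_one_of_one_le₀ hL)

/-- §3 Powers of the level ratio are dominated by the ratio itself: `(Lʲ·(Lᵏ)⁻¹)^m ≤ Lʲ·(Lᵏ)⁻¹` for `1 ≤ m`, `j ≤ k`, `1 ≤ L` (how a knit majorises the
`(Lʲ∕Lᵏ)²`, `(Lʲ∕Lᵏ)⁴` monomials of (F-h)'s and (F-ω)'s closed forms). [cite: Balaban1985Averaging, (47) p.25, (134)-(135) pp.38-39] -/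
theorem pow_levelRatio_le {L : ℝ} (hL : 1 ≤ L) {j k : ℕ} (hjk : j ≤ k) {m : ℕ} (hm : 1 ≤ m) :
    (L ^ j * (L ^ k)⁻¹) ^ m ≤ L ^ j * (L ^ k)⁻¹ :=
  pow_le_of_le_one (levelRatio_nonneg (by linarith) j k) (levelRatio_le_one hL hjk) (by omega)

/-- §3 The split square `(Lʲ)²·((Lᵏ)⁻¹)²` ((F-h)'s letter) is the square of the level ratio. [cite: Balaban1985Averaging, (134)-(135) pp.38-39] -/
theorem sq_mul_inv_sq_eq {L : ℝ} (j k : ℕ) : (L ^ j) ^ 2 * ((L ^ k)⁻¹) ^ 2 = (L ^ j * (L ^ k)⁻¹) ^ 2 := by ring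

/-- §3 For `j < k` and `1 ≤ L`: `Lʲ·(Lᵏ)⁻¹ ≤ (L⁻¹)^{k−1−j}` (one spare factor `L⁻¹ ≤ 1`) — the level ratio in the exponent convention of
✓`HalvingBalLevelRecursion` (`t^{k−(j+1)}` at step `j`). [cite: Balaban1985Averaging, (47) p.25] -/
theorem levelRatio_le_inv_pow {L : ℝ} (hL : 1 ≤ L) {j k : ℕ} (hjk : j < k) : L ^ j * (L ^ k)⁻¹ ≤ (L⁻¹) ^ (k - (j + 1)) := by
  have hL0 : 0 < L := by linarith
  rw [levelRatio_eq_inv_pow hL0 hjk.le, show k - j = (k - (j + 1)) + 1 by omega, pow_succ]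
  have h1 : L⁻¹ ≤ 1 := inv_le_one_of_one_le₀ hL
  have h0 : 0 ≤ (L⁻¹) ^ (k - (j + 1)) := by positivity
  calc (L⁻¹) ^ (k - (j + 1)) * L⁻¹ ≤ (L⁻¹) ^ (k - (j + 1)) * 1 := mul_le_mul_of_nonneg_left h1 h0
    _ = _ := mul_one _

/-- §3 A size dominated by a nonnegative constant times the level ratio is dominated by the constant (`j ≤ k`, `1 ≤ L`) — how a knit reads the uniform windows
`hh j ≤ 1∕64`, `ω j ≤ 1∕600` of ★★★`HalvingEffGaugeRowG.hG_of_rows` off the geometric majorants. [cite: Balaban1985Averaging, (47) p.25] -/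
theorem le_of_le_mul_levelRatio {L c x : ℝ} (hL : 1 ≤ L) (hc : 0 ≤ c) {j k : ℕ} (hjk : j ≤ k) (hx : x ≤ c * (L ^ j * (L ^ k)⁻¹)) : x ≤ c :=
  hx.trans (mul_le_of_le_one_right hc (levelRatio_le_one hL hjk))

/-- §3 ★ **ADAPTER FOR ROW (F-h)'s CLOSED FORM** (✓`HalvingDbarStairSizes` ∕ `HalvingDbarStairRowsOfGuards.stairSizes_of_guards_inAx`, whose stair size at level `j` reads
`4ℓ·(dd·(4ε₀·(Lʲ)²·((Lᵏ)⁻¹)²) + (102∕100)·(R·((Lʲ)⁴·((Lᵏ)⁻¹)⁴)))` with `ℓ = (d+2)L`, `dd = d(L−1)`, `R = 240c₁δc²ε₀²` — any nonnegative reals here): it is at most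
`4ℓ·(dd·(4ε₀) + (102∕100)·R)·(Lʲ·(Lᵏ)⁻¹)` for `j ≤ k`, `1 ≤ L` — the shape `hs·(Lʲ·(Lᵏ)⁻¹)` of `exists_levelSeq_rows_L`. [cite: Balaban1985Averaging, Prop. 4 (134)-(135) pp.38-39] -/
theorem stairSize_closedForm_le_mul_levelRatio {L ℓ dd ε₀ R : ℝ} (hL : 1 ≤ L) (hℓ : 0 ≤ ℓ) (hdd : 0 ≤ dd) (hε₀ : 0 ≤ ε₀) (hR : 0 ≤ R)
    {j k : ℕ} (hjk : j ≤ k) :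
    4 * ℓ * (dd * (4 * ε₀ * (L ^ j) ^ 2 * ((L ^ k)⁻¹) ^ 2) + 102 / 100 * (R * ((L ^ j) ^ 4 * ((L ^ k)⁻¹) ^ 4))) ≤
      4 * ℓ * (dd * (4 * ε₀) + 102 / 100 * R) * (L ^ j * (L ^ k)⁻¹) := by
  have h2 : (L ^ j) ^ 2 * ((L ^ k)⁻¹) ^ 2 ≤ L ^ j * (L ^ k)⁻¹ := by
    rw [← mul_pow]; exact pow_levelRatio_le hL hjk (by norm_num)
  have h4 : (L ^ j) ^ 4 * ((L ^ k)⁻¹) ^ 4 ≤ L ^ j * (L ^ k)⁻¹ := by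
    rw [← mul_pow]; exact pow_levelRatio_le hL hjk (by norm_num)
  have hA : dd * (4 * ε₀ * (L ^ j) ^ 2 * ((L ^ k)⁻¹) ^ 2) ≤ dd * (4 * ε₀) * (L ^ j * (L ^ k)⁻¹) := by
    have e : dd * (4 * ε₀ * (L ^ j) ^ 2 * ((L ^ k)⁻¹) ^ 2) = dd * (4 * ε₀) * ((L ^ j) ^ 2 * ((L ^ k)⁻¹) ^ 2) := by ring
    rw [e]
    exact mul_le_mul_of_nonneg_left h2 (by positivity)
  have hB : 102 / 100 * (R * ((L ^ j) ^ 4 * ((L ^ k)⁻¹) ^ 4)) ≤ 102 / 100 * R * (L ^ j * (L ^ k)⁻¹) := by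
    have e : 102 / 100 * (R * ((L ^ j) ^ 4 * ((L ^ k)⁻¹) ^ 4)) = 102 / 100 * R * ((L ^ j) ^ 4 * ((L ^ k)⁻¹) ^ 4) := by ring
    rw [e]
    exact mul_le_mul_of_nonneg_left h4 (by positivity)
  have hℓ4 : 0 ≤ 4 * ℓ := by positivity
  calc 4 * ℓ * (dd * (4 * ε₀ * (L ^ j) ^ 2 * ((L ^ k)⁻¹) ^ 2) + 102 / 100 * (R * ((L ^ j) ^ 4 * ((L ^ k)⁻¹) ^ 4)))
      ≤ 4 * ℓ * (dd * (4 * ε₀) * (L ^ j * (L ^ k)⁻¹) + 102 / 100 * R * (L ^ j * (L ^ k)⁻¹)) :=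
        mul_le_mul_of_nonneg_left (add_le_add hA hB) hℓ4
    _ = 4 * ℓ * (dd * (4 * ε₀) + 102 / 100 * R) * (L ^ j * (L ^ k)⁻¹) := by ring

/-- ★ **THE FOUR ROWS IN THE SUPPLIERS' LETTER.**  `3 ≤ L`, nonnegative `hh j ≤ h⋆·(Lʲ·(Lᵏ)⁻¹)`, `ω j ≤ w⋆·(Lʲ·(Lᵏ)⁻¹)` (`j < k`) and the two windows
`160·(3b) + 9900·w⋆ + 16128·h⋆ ≤ 1`, `3b ≤ 1∕200`, `b = 23040·h⋆·w⋆ + 4800·w⋆²` ⇒ a level sequence `E` with `hG_of_rows`'s rows `hE0 hE1 hE hθG` at any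
`θG ≥ 3b` — independent of `k`. [cite: Balaban1985Averaging, Prop. 4 (134)-(135) pp.38-39, (139)-(144) pp.39-40; Balaban1985RegularSpaces, (1.29) p.81] -/
theorem exists_levelSeq_rows_L (k : ℕ) {L hs ws θG : ℝ} (hL : 3 ≤ L) (hhs : 0 ≤ hs) (hws : 0 ≤ ws)
    (hh ω : ℕ → ℝ) (hh0 : ∀ j, j < k → 0 ≤ hh j) (hω0 : ∀ j, j < k → 0 ≤ ω j)
    (hhh : ∀ j, j < k → hh j ≤ hs * (L ^ j * (L ^ k)⁻¹)) (hωω : ∀ j, j < k → ω j ≤ ws * (L ^ j * (L ^ k)⁻¹))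
    (hwin : 160 * (3 * (23040 * hs * ws + 4800 * ws ^ 2)) + 9900 * ws + 16128 * hs ≤ 1)
    (hsmall : 3 * (23040 * hs * ws + 4800 * ws ^ 2) ≤ 1 / 200) (hθG : 3 * (23040 * hs * ws + 4800 * ws ^ 2) ≤ θG) :
    ∃ E : ℕ → ℝ, 0 ≤ E 0 ∧ (∀ j, j ≤ k → E j ≤ 1 / 200) ∧
      (∀ j, j < k →
        E j + 160 * E j ^ 2 + 3300 * E j * (3 * ω j) + 5 * (1536 * hh j * (3 * ω j + 21 / 10 * E j)) + 4 * (1200 * ω j ^ 2) ≤ E (j + 1)) ∧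
      E k ≤ θG := by
  have hL1 : 1 ≤ L := by linarith
  have ht0 : 0 ≤ L⁻¹ := by positivity
  have ht1 : L⁻¹ ≤ 1 / 3 := by rw [one_div]; exact inv_anti₀ (by norm_num) hL
  refine exists_levelSeq_rows k ht0 ht1 hhs hws hh ω hh0 hω0 (fun j hj => (hhh j hj).trans ?_) (fun j hj => (hωω j hj).trans ?_) hwin hsmall hθG
  · exact mul_le_mul_of_nonneg_left (levelRatio_le_inv_pow hL1 hj) hhs
  · exact mul_le_mul_of_nonneg_left (levelRatio_le_inv_pow hL1 hj) hws

/-! ## §4 (v1.1) ADAPTER FOR ROW (F-ω)'s CLOSED FORM (`HalvingOmegaRowMember.omegaRow_of_guards`, the `c′`-free v3 letter)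

The ω-row bounds the in-block oscillation of `R̄ʲu₁` at level `j` by the closed form `X + 2A + A² + (2A + A²)·X` with
`X = d(L−1)·(256(d+1)(d+4)·(2ε₀)·(Lʲ(Lᵏ)⁻¹)² + Lʲ·(η·c′max))`, `A = 64d·(Lʲ·(η·c′max))`, `η = L^{−k}`, `c′max = (8·3800·((d+2)L)²)⁻¹`.  Both `X` and `A` are
`≤ const·(Lʲ(Lᵏ)⁻¹)`, and the form scales: `form(x⋆r, a⋆r) ≤ form(x⋆, a⋆)·r` for `0 ≤ r ≤ 1` — so `ω j ≤ w⋆·(Lʲ(Lᵏ)⁻¹)` with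
`w⋆ = form(d(L−1)·(256(d+1)(d+4)(2ε₀) + c′max), 64d·c′max)`, the shape `exists_levelSeq_rows_L` reads. -/

/-- §4 The oscillation form `X + 2A + A² + (2A + A²)·X` under linear majorants `X ≤ x⋆·r`, `A ≤ a⋆·r` with `0 ≤ r ≤ 1` is at most `form(x⋆, a⋆)·r`
(monotonicity in `X, A ≥ 0` and `r², r³ ≤ r`). [cite: Balaban1985Averaging, (84)-(85) pp.30-31, (99) p.32] -/
theorem omegaForm_le_mul_of_le_mul {X A xs as r : ℝ} (hX0 : 0 ≤ X) (hA0 : 0 ≤ A) (hr0 : 0 ≤ r) (hr1 : r ≤ 1) (hxs : 0 ≤ xs) (has : 0 ≤ as)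
    (hX : X ≤ xs * r) (hA : A ≤ as * r) :
    X + 2 * A + A ^ 2 + (2 * A + A ^ 2) * X ≤ (xs + 2 * as + as ^ 2 + (2 * as + as ^ 2) * xs) * r := by
  have hr2 : r * r ≤ r := by nlinarith
  have hA2 : A ^ 2 ≤ as ^ 2 * r := by
    have h1 : A ^ 2 ≤ (as * r) ^ 2 := pow_le_pow_left₀ hA0 hA 2
    have h2 : (as * r) ^ 2 = as ^ 2 * (r * r) := by ring
    have h3 : as ^ 2 * (r * r) ≤ as ^ 2 * r := mul_le_mul_of_nonneg_left hr2 (sq_nonneg as)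
    linarith
  have hmix : (2 * A + A ^ 2) * X ≤ ((2 * as + as ^ 2) * xs) * r := by
    have h1 : 2 * A + A ^ 2 ≤ (2 * as + as ^ 2) * r := by nlinarith
    have h0 : 0 ≤ (2 * as + as ^ 2) * r := by positivity
    have h2 : (2 * A + A ^ 2) * X ≤ ((2 * as + as ^ 2) * r) * (xs * r) := mul_le_mul h1 hX hX0 h0
    have h3 : ((2 * as + as ^ 2) * r) * (xs * r) = ((2 * as + as ^ 2) * xs) * (r * r) := by ring
    have h4 : ((2 * as + as ^ 2) * xs) * (r * r) ≤ ((2 * as + as ^ 2) * xs) * r := mul_le_mul_of_nonneg_left hr2 (by positivity)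
    linarith
  nlinarith

/-- §4 The `η`-letter of the (F-ω) supplier is the level ratio: `Lʲ·((L⁻¹)ᵏ·c) = c·(Lʲ·(Lᵏ)⁻¹)`. [cite: Balaban1985Averaging, (47) p.25] -/
theorem pow_mul_inv_pow_mul_eq {L c : ℝ} (j k : ℕ) : L ^ j * ((L⁻¹) ^ k * c) = c * (L ^ j * (L ^ k)⁻¹) := by
  rw [inv_pow]; ring

/-- §4 ★ **ADAPTER FOR ROW (F-ω)'s CLOSED FORM** (`HalvingOmegaRowMember.omegaRow_of_guards` v3, whose oscillation at level `j` reads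
`D·(C·(2ε₀)·r² + s) + 2·(G·s) + (G·s)² + (2·(G·s) + (G·s)²)·(D·(C·(2ε₀)·r² + s))` with `D = d(L−1)`, `C = 256(d+1)(d+4)`, `G = 64d`, `r = Lʲ(Lᵏ)⁻¹`,
`s = Lʲ·(η·c′max)` — any nonnegative reals here, `0 ≤ r ≤ 1`, `s ≤ c′max·r`): it is at most `w⋆·r` with
`w⋆ = x⋆ + 2a⋆ + a⋆² + (2a⋆ + a⋆²)·x⋆`, `x⋆ = D·(C·(2ε₀) + c′max)`, `a⋆ = G·c′max` — the shape `ws·(Lʲ·(Lᵏ)⁻¹)` of `exists_levelSeq_rows_L`.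
[cite: Balaban1985Averaging, (84)-(85) pp.30-31, (99) p.32, (163) p.42; Balaban1985RegularSpaces, (1.29) p.81] -/
theorem omega_closedForm_le_mul_levelRatio {D C ε₀ G cmax r s : ℝ} (hD : 0 ≤ D) (hC : 0 ≤ C) (hε₀ : 0 ≤ ε₀) (hG : 0 ≤ G) (hcmax : 0 ≤ cmax)
    (hr0 : 0 ≤ r) (hr1 : r ≤ 1) (hs0 : 0 ≤ s) (hs : s ≤ cmax * r) :
    D * (C * (2 * ε₀) * r ^ 2 + s) + 2 * (G * s) + (G * s) ^ 2 + (2 * (G * s) + (G * s) ^ 2) * (D * (C * (2 * ε₀) * r ^ 2 + s)) ≤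
      (D * (C * (2 * ε₀) + cmax) + 2 * (G * cmax) + (G * cmax) ^ 2 + (2 * (G * cmax) + (G * cmax) ^ 2) * (D * (C * (2 * ε₀) + cmax))) * r := by
  have hr2 : r ^ 2 ≤ r := by nlinarith
  have hX0 : 0 ≤ D * (C * (2 * ε₀) * r ^ 2 + s) := by positivity
  have hA0 : 0 ≤ G * s := by positivity
  have hX : D * (C * (2 * ε₀) * r ^ 2 + s) ≤ D * (C * (2 * ε₀) + cmax) * r := by
    have h1 : C * (2 * ε₀) * r ^ 2 + s ≤ (C * (2 * ε₀) + cmax) * r := by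
      have := mul_le_mul_of_nonneg_left hr2 (by positivity : 0 ≤ C * (2 * ε₀))
      nlinarith
    have h2 := mul_le_mul_of_nonneg_left h1 hD
    linarith [h2]
  have hA : G * s ≤ G * cmax * r := by
    have := mul_le_mul_of_nonneg_left hs hG
    linarith
  exact omegaForm_le_mul_of_le_mul hX0 hA0 hr0 hr1 (by positivity) (by positivity) hX hA

end Summit.QuantumFields.YangMills.Theorems.HalvingEffGaugeLevelSeq
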